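import Summits.ABC.IUTFork.Conditional.HexHullThresholdGenuineRows
import HarnessLib

/-!
# Branch C / R-H × R-W «GENUINE-NEG» BANDS through R-H row 4's floor-exact hull threshold, UNIFORM in the prime `l` (part A):
# `k = 10` at EVERY prime `71 ≤ l ≤ 881` and `k = 9` at `l ∈ {73, 79, 83, 89, 97, 101}` — the engine's exact reach for `k = 9, 10`

PROOF-ONLY file (0 definitions, 0 `Prop` facts, no instance, no notation) of the abc-iut cell (seat abc-iut-rh-typ-4 gen 2; D-0079 rescue
sub-cells R-H / R-W, lane U; ROUND-2 Q3 input «is the genuine HEX family inside Σ₄ as l grows»). TAKES NO SIDE on [IUTchIII] Cor. 3.12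
(S. Mochizuki, *Inter-universal Teichmüller theory III*, RIMS manuscript, Cor. 3.12 p. 173–174, Step (xi-f) p. 184) or on any author.

INPUT (one application per band; nothing restated): this seat's ENGINE `GenuineK.not_pilotKummerCompatHull_lamSeven_of_not_hullCell` (p473071 ✓)
at the TOP label, local type `B = 15` for even `k` (abc-iut-w4-d087 `GenuineK.localType_lamSeven_fifteen`), `B = 30` for odd `k` (abc-iut-W-neg-1
`…_thirty`); §1 extends the cell tables of `HexHullThresholdGenuineRows` (p473785 ✓, primes `≤ 71`) by `interval_cases l` over prime bands in
chunks of ≤ 260 values (default heartbeats; composites dismissed by `norm_num`, cells by `norm_num`); §2 the band theorems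
`HexHullThreshold.not_pilotKummerCompatHull_lamSeven_ten_band` (`l.Prime`, `71 ≤ l ≤ 881`) and `…_nine_high` (`l ∈ {73, …, 101}`): at EVERY genuine
Θ-volume datum `T` over `(ratPoint λ_k, l)`, for EVERY choice of the free binders, `PilotKummerCompatHull` at the sharp genuine setting with the CHOSEN
realising ideles and the PINNED reading FAILS.
KERNEL HEX FRONTIER after parts A/B (refuted side, genuine `K`-line; with p473785 and abc-iut-W-neg-2's p462253 / p462041): `8 @ 11–71`,
`9 @ 11–101`, `10 @ 11–881`, `11 @ 13–811`, `12 @ 11–1680`, `k ≥ 13 @ 11–3361` (`l ∤ k`). THE REACH IS EXACT for this engine: the column does NOT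
fail at every admissible `d` at `(8, 73)`, `(9, 103)`, `(10, 883)`, `(11, 821)` (seat-side exact scan; `(8, l ≥ 73)` is cell-INHABITED at the genuine
type `e_v = 15`, rw-num-lead 22:57:52Z) — WINDOW candidates there, in agreement with the R-W table and the round-2 Q3 law «for fixed `k` the
family re-enters Σ₄ as `l` grows».
HONEST SCOPE: SHARP reading; the per-label licence is a STRONGER-THAN-PRINT sufficient form of (xi-f); a failing top-label diagonal packet says
NOTHING about the printed GLOBAL inequality, the number-level `Cor22.Cor312AtDatum`, or any author's intended hull; HEX rows are Szpiro-GOOD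
(window binder `hSHw` of the uncut records only); admissibility `CondP6` of `(λ_k, l)` is NOT asserted (the theorems hold at every datum `T`);
no side taken on any author; typed ≠ proved; refuted-as-typed ≠ refuted-in-print; no abc claim.
[cite: Mochizuki2012, IUTchIII Cor. 3.12 Step (xi-f) p. 184; IUTchIV Prop. 1.1 p. 9, Prop. 1.2 (i)(ii) p. 10] [cite: DupuyHilado2025, §3.4, §4.9, §4.12]
[claim: Mochizuki2012, status: disputed] for every IUT quotation.
-/

noncomputable section

open Set Function NumberField IsDedekindDomain

namespace Summit.ABC.IUTFork.Conditional

open Thm311 Thm311.Real Cor312 Cor312Vol Cor312Prov Literature.IUT.LogThetaLattice Literature.IUT.LogVolume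
  Literature.IUT.HodgeTheaters Literature.IUT.LogVolume.ThetaData
  Literature.NumberTheory.NumberFields Literature.NumberTheory.DiophantineGeometry.GenEll
  Literature.NumberTheory.DiophantineGeometry Summit.ABC.ABC.Theorems Literature.NumberTheory.GaloisRepresentations.Ultrametric
  Summit.ABC.IUTFork.Repair.RH.HullThresholdExact

/-! ## §1. Cell tables over prime bands (`k = 10`: three chunks; `k = 9`: six primes) -/

/-- **CELL TABLE, `k = 10`, EVERY prime `71 ≤ l ≤ 330` (`B = 15`)**: for every `d ∣ 15` the column `HullCell` FAILS at
`(l·d, 10·d, l⋇, ⌊l·d/6⌋+1, 7^{a₀} − a₀·l·d)`, `a₀` the turning point; `interval_cases l`, composites by `norm_num`, cells by `norm_num`. [folklore] -/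
theorem HexHullThreshold.cells_ten_band1 : ∀ l : ℕ, 71 ≤ l → l ≤ 330 → l.Prime →
    ∀ d : ℕ, d ∣ 15 → ∃ a₀ : ℕ, (∀ a, a < a₀ → (1 : ℤ) * (7 : ℤ) ^ a * ((7 : ℤ) - 1) < ((l * d : ℕ) : ℤ)) ∧
      ((l * d : ℕ) : ℤ) ≤ 1 * (7 : ℤ) ^ a₀ * ((7 : ℤ) - 1) ∧
      ¬ HullCell ((l * d : ℕ) : ℤ) ((10 * d : ℕ) : ℤ) ((((l - 1) / 2 - 1 : ℕ) : ℤ) + 1) ((l * d / 6 + 1 : ℕ) : ℤ)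
        ((7 : ℤ) ^ a₀ - (a₀ : ℤ) * ((l * d : ℕ) : ℤ)) := by
  intro l hlo hhi hl d hd
  interval_cases l
  all_goals
    first
    | (exfalso; norm_num at hl; done)
    | (rcases HexHullThreshold.eq_of_dvd_fifteen hd with rfl | rfl | rfl | rfl
       all_goals
        first
        | (refine ⟨2, ?_, ?_, ?_⟩ <;>
            [(intro a ha; interval_cases a <;> (norm_num; done)); (norm_num; done); (norm_num [HullCell]; done)])
        | (refine ⟨3, ?_, ?_, ?_⟩ <;>
            [(intro a ha; interval_cases a <;> (norm_num; done)); (norm_num; done); (norm_num [HullCell]; done)])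
        | (refine ⟨4, ?_, ?_, ?_⟩ <;>
            [(intro a ha; interval_cases a <;> (norm_num; done)); (norm_num; done); (norm_num [HullCell]; done)]))

/-- **CELL TABLE, `k = 10`, EVERY prime `331 ≤ l ≤ 600` (`B = 15`)**: for every `d ∣ 15` the column `HullCell` FAILS at
`(l·d, 10·d, l⋇, ⌊l·d/6⌋+1, 7^{a₀} − a₀·l·d)`, `a₀` the turning point; `interval_cases l`, composites by `norm_num`, cells by `norm_num`. [folklore] -/
theorem HexHullThreshold.cells_ten_band2 : ∀ l : ℕ, 331 ≤ l → l ≤ 600 → l.Prime →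
    ∀ d : ℕ, d ∣ 15 → ∃ a₀ : ℕ, (∀ a, a < a₀ → (1 : ℤ) * (7 : ℤ) ^ a * ((7 : ℤ) - 1) < ((l * d : ℕ) : ℤ)) ∧
      ((l * d : ℕ) : ℤ) ≤ 1 * (7 : ℤ) ^ a₀ * ((7 : ℤ) - 1) ∧
      ¬ HullCell ((l * d : ℕ) : ℤ) ((10 * d : ℕ) : ℤ) ((((l - 1) / 2 - 1 : ℕ) : ℤ) + 1) ((l * d / 6 + 1 : ℕ) : ℤ)
        ((7 : ℤ) ^ a₀ - (a₀ : ℤ) * ((l * d : ℕ) : ℤ)) := by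
  intro l hlo hhi hl d hd
  interval_cases l
  all_goals
    first
    | (exfalso; norm_num at hl; done)
    | (rcases HexHullThreshold.eq_of_dvd_fifteen hd with rfl | rfl | rfl | rfl
       all_goals
        first
        | (refine ⟨3, ?_, ?_, ?_⟩ <;>
            [(intro a ha; interval_cases a <;> (norm_num; done)); (norm_num; done); (norm_num [HullCell]; done)])
        | (refine ⟨4, ?_, ?_, ?_⟩ <;>
            [(intro a ha; interval_cases a <;> (norm_num; done)); (norm_num; done); (norm_num [HullCell]; done)]))

/-- **CELL TABLE, `k = 10`, EVERY prime `601 ≤ l ≤ 881` (`B = 15`)**: for every `d ∣ 15` the column `HullCell` FAILS at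
`(l·d, 10·d, l⋇, ⌊l·d/6⌋+1, 7^{a₀} − a₀·l·d)`, `a₀` the turning point; `interval_cases l`, composites by `norm_num`, cells by `norm_num`. [folklore] -/
theorem HexHullThreshold.cells_ten_band3 : ∀ l : ℕ, 601 ≤ l → l ≤ 881 → l.Prime →
    ∀ d : ℕ, d ∣ 15 → ∃ a₀ : ℕ, (∀ a, a < a₀ → (1 : ℤ) * (7 : ℤ) ^ a * ((7 : ℤ) - 1) < ((l * d : ℕ) : ℤ)) ∧
      ((l * d : ℕ) : ℤ) ≤ 1 * (7 : ℤ) ^ a₀ * ((7 : ℤ) - 1) ∧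
      ¬ HullCell ((l * d : ℕ) : ℤ) ((10 * d : ℕ) : ℤ) ((((l - 1) / 2 - 1 : ℕ) : ℤ) + 1) ((l * d / 6 + 1 : ℕ) : ℤ)
        ((7 : ℤ) ^ a₀ - (a₀ : ℤ) * ((l * d : ℕ) : ℤ)) := by
  intro l hlo hhi hl d hd
  interval_cases l
  all_goals
    first
    | (exfalso; norm_num at hl; done)
    | (rcases HexHullThreshold.eq_of_dvd_fifteen hd with rfl | rfl | rfl | rfl
       all_goals
        first
        | (refine ⟨3, ?_, ?_, ?_⟩ <;>
            [(intro a ha; interval_cases a <;> (norm_num; done)); (norm_num; done); (norm_num [HullCell]; done)])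
        | (refine ⟨4, ?_, ?_, ?_⟩ <;>
            [(intro a ha; interval_cases a <;> (norm_num; done)); (norm_num; done); (norm_num [HullCell]; done)]))

/-- **CELL TABLE, `k = 9`, `l ∈ {73, 79, 83, 89, 97, 101}` (`B = 30`)**: for every `d ∣ 30` the column `HullCell` FAILS at the same integers. [folklore] -/
theorem HexHullThreshold.cells_nine_high : ∀ l ∈ ({73, 79, 83, 89, 97, 101} : Finset ℕ),
    ∀ d : ℕ, d ∣ 30 → ∃ a₀ : ℕ, (∀ a, a < a₀ → (1 : ℤ) * (7 : ℤ) ^ a * ((7 : ℤ) - 1) < ((l * d : ℕ) : ℤ)) ∧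
      ((l * d : ℕ) : ℤ) ≤ 1 * (7 : ℤ) ^ a₀ * ((7 : ℤ) - 1) ∧
      ¬ HullCell ((l * d : ℕ) : ℤ) ((9 * d : ℕ) : ℤ) ((((l - 1) / 2 - 1 : ℕ) : ℤ) + 1) ((l * d / 6 + 1 : ℕ) : ℤ)
        ((7 : ℤ) ^ a₀ - (a₀ : ℤ) * ((l * d : ℕ) : ℤ)) := by
  intro l hl d hd
  simp only [Finset.mem_insert, Finset.mem_singleton] at hl
  rcases hl with rfl | rfl | rfl | rfl | rfl | rfl
  all_goals
    rcases Summit.ABC.IUTFork.Repair.CandInternal2RealGapRows.eq_of_dvd_thirty hd with rfl | rfl | rfl | rfl | rfl | rfl | rfl | rfl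
    all_goals
      first
      | (refine ⟨2, ?_, ?_, ?_⟩ <;>
          [(intro a ha; interval_cases a <;> (norm_num; done)); (norm_num; done); (norm_num [HullCell]; done)])
      | (refine ⟨3, ?_, ?_, ?_⟩ <;>
          [(intro a ha; interval_cases a <;> (norm_num; done)); (norm_num; done); (norm_num [HullCell]; done)])
      | (refine ⟨4, ?_, ?_, ?_⟩ <;>
          [(intro a ha; interval_cases a <;> (norm_num; done)); (norm_num; done); (norm_num [HullCell]; done)])

/-! ## §2. The bands -/

/-- **GENUINE-NEG, `k = 10`, EVERY prime `71 ≤ l ≤ 881` (`11–71`: p473785)**: at EVERY genuine Θ-volume datum `T` over `(ratPoint λ_10, l)`, for EVERY choice of the free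
context binders and Kummer data, `Cor312Vol.PilotKummerCompatHull` at the sharp genuine setting with the CHOSEN realising ideles and the PINNED
reading FAILS — the engine p473071 at `B = 15`, top label, cells of §1. [cite: Mochizuki2012, IUTchIII Cor. 3.12 Step (xi-f) p. 184; IUTchIV Prop. 1.2 (i)(ii) p. 10]
[claim: Mochizuki2012, status: disputed] -/
theorem HexHullThreshold.not_pilotKummerCompatHull_lamSeven_ten_band {l : ℕ} (hl : l.Prime) (hlo : 71 ≤ l) (hhi : l ≤ 881)
    (T : Cor22.ThetaVolumeDatumAt (ratPoint ((2 : ℚ)⁻¹ + 2 / 7 ^ 10)) l) :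
    letI := T.instFieldF; letI := T.instNumberFieldF; letI := T.instAlgebraF; letI := T.instFieldK
    letI := T.instNumberFieldK; letI := T.instAlgebraK; letI := T.instFieldFbar; letI := T.instAlgebraFbar
    letI := T.instAlgebraKFbar; letI := T.instIsElliptic
    ∀ (M : Type) [Field M] [NumberField M]
      (archPk : ∀ (j : (thetaIndex (pilotDataOfK T.D T.K)).Label) (vQ : (thetaIndex (pilotDataOfK T.D T.K)).VQ),
        Set ((logShellsDH (pilotDataOfK T.D T.K) (analyticLogv T.K)).Packet j vQ))
      (archSub : ∀ (j : (thetaIndex (pilotDataOfK T.D T.K)).Label) (v : (thetaIndex (pilotDataOfK T.D T.K)).V),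
        Set ((logShellsDH (pilotDataOfK T.D T.K) (analyticLogv T.K)).Packet j ((thetaIndex (pilotDataOfK T.D T.K)).over v)))
      (Ψ : ℤ → ∀ v : (thetaIndex (pilotDataOfK T.D T.K)).V, v ∈ (thetaIndex (pilotDataOfK T.D T.K)).Vbad →
        Set ((logShellsDH (pilotDataOfK T.D T.K) (analyticLogv T.K)).StarPacket v))
      (act : ℤ → ∀ v : (thetaIndex (pilotDataOfK T.D T.K)).V, v ∈ (thetaIndex (pilotDataOfK T.D T.K)).Vbad →
        (logShellsDH (pilotDataOfK T.D T.K) (analyticLogv T.K)).StarPacket v →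
          Module.End ℚ ((logShellsDH (pilotDataOfK T.D T.K) (analyticLogv T.K)).StarPacket v))
      (Mmod : ℤ → ∀ j : (thetaIndex (pilotDataOfK T.D T.K)).LabelStar,
        Set ((logShellsDH (pilotDataOfK T.D T.K) (analyticLogv T.K)).GlobalPacket j.1))
      (region : ℤ → ∀ j : (thetaIndex (pilotDataOfK T.D T.K)).LabelStar, FinDivisor M →
        ∀ vQ : (thetaIndex (pilotDataOfK T.D T.K)).VQ, Set ((logShellsDH (pilotDataOfK T.D T.K) (analyticLogv T.K)).Packet j.1 vQ))
      (frobAdm : ℤ → ℤ → ∀ (j : (thetaIndex (pilotDataOfK T.D T.K)).Label) (vQ : (thetaIndex (pilotDataOfK T.D T.K)).VQ),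
        Set ((logShellsDH (pilotDataOfK T.D T.K) (analyticLogv T.K)).Packet j vQ) → Prop)
      (frobLogvol : ℤ → ℤ → ∀ (j : (thetaIndex (pilotDataOfK T.D T.K)).Label) (vQ : (thetaIndex (pilotDataOfK T.D T.K)).VQ),
        Set ((logShellsDH (pilotDataOfK T.D T.K) (analyticLogv T.K)).Packet j vQ) → ℝ)
      (frobΨ : ℤ → ℤ → ∀ v : (thetaIndex (pilotDataOfK T.D T.K)).V, v ∈ (thetaIndex (pilotDataOfK T.D T.K)).Vbad →
        Set ((logShellsDH (pilotDataOfK T.D T.K) (analyticLogv T.K)).StarPacket v))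
      (frobMmod : ℤ → ℤ → ∀ j : (thetaIndex (pilotDataOfK T.D T.K)).LabelStar,
        Set ((logShellsDH (pilotDataOfK T.D T.K) (analyticLogv T.K)).GlobalPacket j.1))
      (unitImage : ℤ → ℤ → ℕ → ∀ (j : (thetaIndex (pilotDataOfK T.D T.K)).Label) (vQ : (thetaIndex (pilotDataOfK T.D T.K)).VQ),
        Set ((logShellsDH (pilotDataOfK T.D T.K) (analyticLogv T.K)).Packet j vQ))
      (ballImage : ℤ → ℤ → ∀ (j : (thetaIndex (pilotDataOfK T.D T.K)).Label) (vQ : (thetaIndex (pilotDataOfK T.D T.K)).VQ),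
        Set ((logShellsDH (pilotDataOfK T.D T.K) (analyticLogv T.K)).Packet j vQ))
      (thetaDiv : ℤ → ℤ → LgpDivisor M (thetaIndex (pilotDataOfK T.D T.K)).lstar)
      (n : ℤ) {HT : Type} {LogLink : HT → HT → Type} {IsFull : ∀ {s t : HT}, LogLink s t → Prop}
      (lat : LGPGaussianLogThetaLattice LogLink IsFull)
      {Frd : Type} {IsoF : Frd → Frd → Type} {Ob : Frd → Type} {realify : Frd → Frd} {Strip : Type}
      {IsoS : Strip → Strip → Type} {Mv : ∀ v : (thetaIndex (pilotDataOfK T.D T.K)).V, v ∈ (thetaIndex (pilotDataOfK T.D T.K)).Vbad → Type}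
      [∀ v h, Monoid (Mv v h)]
      (sig : GlobalLGPFrobenioidSignature (thetaIndex (pilotDataOfK T.D T.K)).lstar (thetaIndex (pilotDataOfK T.D T.K)).V
        (· ∈ (thetaIndex (pilotDataOfK T.D T.K)).Vbad) Frd IsoF Ob realify Strip IsoS Mv)
      (split : SplittingMonoids Mv) {ObΔ : Type}
      {N : ∀ v : (thetaIndex (pilotDataOfK T.D T.K)).V, v ∈ (thetaIndex (pilotDataOfK T.D T.K)).Vbad → Type}
      [∀ v h, Monoid (N v h)] (qData : QPilotData ObΔ N)
      (qK : ∀ v : (thetaIndex (pilotDataOfK T.D T.K)).V, v ∈ (thetaIndex (pilotDataOfK T.D T.K)).Vbad →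
        Set ((logShellsDH (pilotDataOfK T.D T.K) (analyticLogv T.K)).StarPacket v)),
    ¬ Cor312Vol.PilotKummerCompatHull
        (LatticeSituation.ofShells (logShellsDH (pilotDataOfK T.D T.K) (analyticLogv T.K)) M archPk archSub
          (summandPiecesPr (pilotDataOfK T.D T.K) (logvAnalytic_analyticLogv (F := T.K))).Adm
          (summandPiecesPr (pilotDataOfK T.D T.K) (logvAnalytic_analyticLogv (F := T.K))).logvol Ψ act Mmod region frobAdm
          frobLogvol frobΨ frobMmod unitImage ballImage thetaDiv)
        (settingPrVolSharp (pilotDataOfK T.D T.K) (logvAnalytic_analyticLogv (F := T.K)) M archPk archSub Ψ act Mmod region n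
          lat sig split qData (exists_realising_qIdeles_pilotDataOfK T.D).choose (exists_realising_thetaIdeles_pilotDataOfK T.D).choose
          (exists_realising_qIdeles_pilotDataOfK T.D).choose_spec.1 (exists_realising_qIdeles_pilotDataOfK T.D).choose_spec.2.1)
        (fun _ => Cor312.Setting.qRegion
          (settingPrVolSharp (pilotDataOfK T.D T.K) (logvAnalytic_analyticLogv (F := T.K)) M archPk archSub Ψ act Mmod region n
            lat sig split qData (exists_realising_qIdeles_pilotDataOfK T.D).choose (exists_realising_thetaIdeles_pilotDataOfK T.D).choose
            (exists_realising_qIdeles_pilotDataOfK T.D).choose_spec.1 (exists_realising_qIdeles_pilotDataOfK T.D).choose_spec.2.1))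
        qK := by
  have hlk : ¬ l ∣ 10 := fun h => by have := Nat.le_of_dvd (by norm_num) h; omega
  have hcell : ∀ d : ℕ, d ∣ 15 → ∃ a₀ : ℕ, (∀ a, a < a₀ → (1 : ℤ) * (7 : ℤ) ^ a * ((7 : ℤ) - 1) < ((l * d : ℕ) : ℤ)) ∧
    ((l * d : ℕ) : ℤ) ≤ 1 * (7 : ℤ) ^ a₀ * ((7 : ℤ) - 1) ∧
    ¬ HullCell ((l * d : ℕ) : ℤ) ((10 * d : ℕ) : ℤ) ((((l - 1) / 2 - 1 : ℕ) : ℤ) + 1) ((l * d / 6 + 1 : ℕ) : ℤ)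
    ((7 : ℤ) ^ a₀ - (a₀ : ℤ) * ((l * d : ℕ) : ℤ)) := by
    rcases le_or_gt l 330 with h0 | h0
    · exact HexHullThreshold.cells_ten_band1 l (by omega) h0 hl
    rcases le_or_gt l 600 with h1 | h1
    · exact HexHullThreshold.cells_ten_band2 l (by omega) h1 hl
    exact HexHullThreshold.cells_ten_band3 l (by omega) hhi hl
  exact GenuineK.not_pilotKummerCompatHull_lamSeven_of_not_hullCell (B := 15) (i := (l - 1) / 2 - 1) (by norm_num) hl (by omega) hlk
    (by omega) T (fun x₀ => (GenuineK.localType_lamSeven_fifteen (by norm_num) ⟨5, rfl⟩ (by omega) T x₀).2) hcell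

/-- **GENUINE-NEG, `k = 9`, `l ∈ {73, 79, 83, 89, 97, 101}` (`11–71`: p473785)**: at EVERY genuine Θ-volume datum `T` over `(ratPoint λ_9, l)`, for EVERY choice of the free
context binders and Kummer data, `Cor312Vol.PilotKummerCompatHull` at the sharp genuine setting with the CHOSEN realising ideles and the PINNED
reading FAILS — the engine p473071 at `B = 30`, top label, cells of §1. [cite: Mochizuki2012, IUTchIII Cor. 3.12 Step (xi-f) p. 184; IUTchIV Prop. 1.2 (i)(ii) p. 10]
[claim: Mochizuki2012, status: disputed] -/
theorem HexHullThreshold.not_pilotKummerCompatHull_lamSeven_nine_high {l : ℕ} (hl : l ∈ ({73, 79, 83, 89, 97, 101} : Finset ℕ))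
    (T : Cor22.ThetaVolumeDatumAt (ratPoint ((2 : ℚ)⁻¹ + 2 / 7 ^ 9)) l) :
    letI := T.instFieldF; letI := T.instNumberFieldF; letI := T.instAlgebraF; letI := T.instFieldK
    letI := T.instNumberFieldK; letI := T.instAlgebraK; letI := T.instFieldFbar; letI := T.instAlgebraFbar
    letI := T.instAlgebraKFbar; letI := T.instIsElliptic
    ∀ (M : Type) [Field M] [NumberField M]
      (archPk : ∀ (j : (thetaIndex (pilotDataOfK T.D T.K)).Label) (vQ : (thetaIndex (pilotDataOfK T.D T.K)).VQ),
        Set ((logShellsDH (pilotDataOfK T.D T.K) (analyticLogv T.K)).Packet j vQ))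
      (archSub : ∀ (j : (thetaIndex (pilotDataOfK T.D T.K)).Label) (v : (thetaIndex (pilotDataOfK T.D T.K)).V),
        Set ((logShellsDH (pilotDataOfK T.D T.K) (analyticLogv T.K)).Packet j ((thetaIndex (pilotDataOfK T.D T.K)).over v)))
      (Ψ : ℤ → ∀ v : (thetaIndex (pilotDataOfK T.D T.K)).V, v ∈ (thetaIndex (pilotDataOfK T.D T.K)).Vbad →
        Set ((logShellsDH (pilotDataOfK T.D T.K) (analyticLogv T.K)).StarPacket v))
      (act : ℤ → ∀ v : (thetaIndex (pilotDataOfK T.D T.K)).V, v ∈ (thetaIndex (pilotDataOfK T.D T.K)).Vbad →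
        (logShellsDH (pilotDataOfK T.D T.K) (analyticLogv T.K)).StarPacket v →
          Module.End ℚ ((logShellsDH (pilotDataOfK T.D T.K) (analyticLogv T.K)).StarPacket v))
      (Mmod : ℤ → ∀ j : (thetaIndex (pilotDataOfK T.D T.K)).LabelStar,
        Set ((logShellsDH (pilotDataOfK T.D T.K) (analyticLogv T.K)).GlobalPacket j.1))
      (region : ℤ → ∀ j : (thetaIndex (pilotDataOfK T.D T.K)).LabelStar, FinDivisor M →
        ∀ vQ : (thetaIndex (pilotDataOfK T.D T.K)).VQ, Set ((logShellsDH (pilotDataOfK T.D T.K) (analyticLogv T.K)).Packet j.1 vQ))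
      (frobAdm : ℤ → ℤ → ∀ (j : (thetaIndex (pilotDataOfK T.D T.K)).Label) (vQ : (thetaIndex (pilotDataOfK T.D T.K)).VQ),
        Set ((logShellsDH (pilotDataOfK T.D T.K) (analyticLogv T.K)).Packet j vQ) → Prop)
      (frobLogvol : ℤ → ℤ → ∀ (j : (thetaIndex (pilotDataOfK T.D T.K)).Label) (vQ : (thetaIndex (pilotDataOfK T.D T.K)).VQ),
        Set ((logShellsDH (pilotDataOfK T.D T.K) (analyticLogv T.K)).Packet j vQ) → ℝ)
      (frobΨ : ℤ → ℤ → ∀ v : (thetaIndex (pilotDataOfK T.D T.K)).V, v ∈ (thetaIndex (pilotDataOfK T.D T.K)).Vbad →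
        Set ((logShellsDH (pilotDataOfK T.D T.K) (analyticLogv T.K)).StarPacket v))
      (frobMmod : ℤ → ℤ → ∀ j : (thetaIndex (pilotDataOfK T.D T.K)).LabelStar,
        Set ((logShellsDH (pilotDataOfK T.D T.K) (analyticLogv T.K)).GlobalPacket j.1))
      (unitImage : ℤ → ℤ → ℕ → ∀ (j : (thetaIndex (pilotDataOfK T.D T.K)).Label) (vQ : (thetaIndex (pilotDataOfK T.D T.K)).VQ),
        Set ((logShellsDH (pilotDataOfK T.D T.K) (analyticLogv T.K)).Packet j vQ))
      (ballImage : ℤ → ℤ → ∀ (j : (thetaIndex (pilotDataOfK T.D T.K)).Label) (vQ : (thetaIndex (pilotDataOfK T.D T.K)).VQ),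
        Set ((logShellsDH (pilotDataOfK T.D T.K) (analyticLogv T.K)).Packet j vQ))
      (thetaDiv : ℤ → ℤ → LgpDivisor M (thetaIndex (pilotDataOfK T.D T.K)).lstar)
      (n : ℤ) {HT : Type} {LogLink : HT → HT → Type} {IsFull : ∀ {s t : HT}, LogLink s t → Prop}
      (lat : LGPGaussianLogThetaLattice LogLink IsFull)
      {Frd : Type} {IsoF : Frd → Frd → Type} {Ob : Frd → Type} {realify : Frd → Frd} {Strip : Type}
      {IsoS : Strip → Strip → Type} {Mv : ∀ v : (thetaIndex (pilotDataOfK T.D T.K)).V, v ∈ (thetaIndex (pilotDataOfK T.D T.K)).Vbad → Type}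
      [∀ v h, Monoid (Mv v h)]
      (sig : GlobalLGPFrobenioidSignature (thetaIndex (pilotDataOfK T.D T.K)).lstar (thetaIndex (pilotDataOfK T.D T.K)).V
        (· ∈ (thetaIndex (pilotDataOfK T.D T.K)).Vbad) Frd IsoF Ob realify Strip IsoS Mv)
      (split : SplittingMonoids Mv) {ObΔ : Type}
      {N : ∀ v : (thetaIndex (pilotDataOfK T.D T.K)).V, v ∈ (thetaIndex (pilotDataOfK T.D T.K)).Vbad → Type}
      [∀ v h, Monoid (N v h)] (qData : QPilotData ObΔ N)
      (qK : ∀ v : (thetaIndex (pilotDataOfK T.D T.K)).V, v ∈ (thetaIndex (pilotDataOfK T.D T.K)).Vbad →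
        Set ((logShellsDH (pilotDataOfK T.D T.K) (analyticLogv T.K)).StarPacket v)),
    ¬ Cor312Vol.PilotKummerCompatHull
        (LatticeSituation.ofShells (logShellsDH (pilotDataOfK T.D T.K) (analyticLogv T.K)) M archPk archSub
          (summandPiecesPr (pilotDataOfK T.D T.K) (logvAnalytic_analyticLogv (F := T.K))).Adm
          (summandPiecesPr (pilotDataOfK T.D T.K) (logvAnalytic_analyticLogv (F := T.K))).logvol Ψ act Mmod region frobAdm
          frobLogvol frobΨ frobMmod unitImage ballImage thetaDiv)
        (settingPrVolSharp (pilotDataOfK T.D T.K) (logvAnalytic_analyticLogv (F := T.K)) M archPk archSub Ψ act Mmod region n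
          lat sig split qData (exists_realising_qIdeles_pilotDataOfK T.D).choose (exists_realising_thetaIdeles_pilotDataOfK T.D).choose
          (exists_realising_qIdeles_pilotDataOfK T.D).choose_spec.1 (exists_realising_qIdeles_pilotDataOfK T.D).choose_spec.2.1)
        (fun _ => Cor312.Setting.qRegion
          (settingPrVolSharp (pilotDataOfK T.D T.K) (logvAnalytic_analyticLogv (F := T.K)) M archPk archSub Ψ act Mmod region n
            lat sig split qData (exists_realising_qIdeles_pilotDataOfK T.D).choose (exists_realising_thetaIdeles_pilotDataOfK T.D).choose
            (exists_realising_qIdeles_pilotDataOfK T.D).choose_spec.1 (exists_realising_qIdeles_pilotDataOfK T.D).choose_spec.2.1))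
        qK := by
  have hl' := hl; simp only [Finset.mem_insert, Finset.mem_singleton] at hl'
  obtain ⟨h11, hlp⟩ : 11 ≤ l ∧ l.Prime := by rcases hl' with rfl | rfl | rfl | rfl | rfl | rfl <;> norm_num
  have hlk : ¬ l ∣ 9 := fun h => by have := Nat.le_of_dvd (by norm_num) h; omega
  exact GenuineK.not_pilotKummerCompatHull_lamSeven_of_not_hullCell (B := 30) (i := (l - 1) / 2 - 1) (by norm_num) hlp h11 hlk
    (by omega) T (fun x₀ => (GenuineK.localType_lamSeven_thirty (by norm_num) h11 T x₀).2) (HexHullThreshold.cells_nine_high l hl)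

end Summit.ABC.IUTFork.Conditional

end
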